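import Mathlib
import Summits.Ventures.HodgeRepro2.LiuOscillator

/-!
# Tier7/Lit1 — the printed statements of Liu 2021 that the Tier-7 lines may consume (t7-lit-1)

Cell pub-hodge-repro2, Tier 7 (README §11–§12), seat t7-lit-1 (literature seat 1 of 4). STATEMENT LANE:
`def … : Prop` only — typings of PUBLISHED statements, hypotheses explicit, NO proof of a published theorem.
Source: Yifeng Liu, «Fourier–Jacobi cycles and arithmetic relative trace formula (with an appendix by Chao Li and
Yihang Zhu)», Cambridge J. Math. 9 (2021), no. 1, 1–147, doi:10.4310/cjm.2021.v9.n1.a1 — held PAGE layer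
`paper:liu2021-fourier-jacobi-cycles-arithmetic-relative-trace-formula` (page file `p00NN` = journal page NN; every
locator below is «p. N ll. a–b» = journal page N, raw lines of the page file; the byte-exact blocks are
L1.0–L1.13 of HOME/route/t7/LIT-INDEX-lit-1.md). Named in README §11's quotation as «Liu 2021 Cor 4.20»,
«Liu Rem 4.14», «Liu Prop 4.13».

REUSE, NOT RE-DECLARATION (the typer lint of the tree and the cell's Tier-6 ruling R5 «one opaque shape per printed
source»): the objects of Liu §4.1–§4.2 are ALREADY typed in this tree by p2's Tier-3 lane, namespace
`Summit.Ventures.HodgeRepro2.ShimuraData.Liu` (modules `Liu` p386549, `LiuOscillator` p386919, `LiuFace` p387089,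
`LiuBridge` p387309; host-free): `AutomorphicCharacter` (an automorphic character of `𝔸_E^×`),
`IsConjugateSymplectic` (Def 4.1), `IsWeightOne` (Rem 4.2 / Def 4.3), `OscillatorTriple` (Def 4.11, the
collection `ε` modelled by a global representative `e ∈ E^{×−}`), `IsMuAdmissibleRep` (Def 4.12),
`OscillatorTriple.IsAdmissible` (μ of weight one and ε μ-admissible), the opaque shape `AlbaneseH1Shape`
(`rank` = n, `Rep` = the irreducible admissible representations of `G(𝔸_F^∞)` as a type with `osc` = the
oscillator representation `ω(μ,ε,χ)` of a triple, `mult τ′ π` = the multiplicity of `π` in `H¹_{B,τ′}(A_∞, ℂ)`,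
`Level` with `IsSmall` = the sufficiently small open compact `K`, `dimInv π K` = `dim_ℂ π^K`, `galOrbit` = the
`Gal(ℂ/ℚ)`-orbit relation on characters, `IsogClass` = isogeny classes of abelian varieties over `E` as a commutative
monoid, `albanese K` = `A_K`, `cmVariety μ` = `A_μ`, `homDim K μ` = `dim_{M̃_μ} Hom_E(A_K, A_μ)_ℚ`,
`omegaInvDim K μ` = `dim_{M̃_μ} Ω(μ)^K`), and the three statement SHAPES `LiuProp413Shape`, `LiuThm418Shape`,
`LiuCor420Shape` (Props over the shape, never proved), `liuMultiplicity S T K` = `d(μ,K)`. This file does not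
restate them: the Tier-7 displays `Hyp.Liu2021_Prop4_13` / `Hyp.Liu2021_Thm4_18` / `Hyp.Liu2021_Cor4_20` NAME those
shapes under the printed statements (docstring = the print verbatim + locator + the reading p2's shape makes),
so that a line's lemma can display «Liu 2021, Proposition 4.13» by a Tier-7 name and the writer's
proofs/t7/INPUTS.md can point at ONE declaration per printed statement.

NEW HERE (not in the tree): the ADELIC MATSUSHIMA FORMULA (D.1) of Liu's Appendix D.2 (p. 128 ll. 33–49), the
form in which Liu decomposes the cohomology of the tower of Shimura varieties as a smooth `G(𝔸^∞)`-module and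
applies it to `X_K` in the proofs of Proposition 4.13 (p. 47 ll. 46–54) and Theorem 4.15 (p. 50 ll. 36–43) — the
t7-lead's (H9) «Matsushima's formula» (STATUS l. 14523) in its Hecke-equivariant printed form. Shape
`Liu2021D1Shape` (fields named as in print), display `Hyp.Liu2021_D1_Matsushima`. The cocompact-Γ form
(Borel–Wallach VII 3.2) is `Hyp.BW2000_VII_Thm3_2` of Tier7/Lit3.lean (t7-lit-3); the `S(K)`-form with the
`H^{b×q,a×q}` refinement is BMM 2016 (6.7)–(6.8) (t7-lit-2's rows).

NOT TYPED (not statements): Remark 4.14 («When n = 3, Proposition 4.13 can be deduced from [GR91, Rog92].»,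
p. 49 ll. 35–36) names no theorem of either reference; Lemma 4.23(3)'s Hecke translation
`T_g : X_{gKg⁻¹} → X_K` (p. 56 ll. 6–8) and the `G(𝔸_F^∞)`-action on `A_∞` (p. 46 ll. 17–18) are the
`MulAction G HX` of the Tier-7 target datum, not a statement.

Non-vacuity (README §10.5(ii), carried over): no display closes by `trivial` / `simp` / `decide` / `exact ⟨⟩`
(each quantifies over the representations / characters / levels of a shape and asserts multiplicities, a
dimension identity, an isogeny decomposition, or a graded equivariant linear isomorphism); `Liu2021D1Shape` is
inhabited by the zero shape (`Rep = Unit`, every space `0`-dimensional, `mdisc = 0`), which satisfies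
`Hyp.Liu2021_D1_Matsushima` (scratch `example`, seat NOTES, not shipped); the three p2-shape displays are the
tree's own Props (their inhabitation is p2's LiuFace / T6 toy record).

§8(d): uses an L-value-free non-vanishing device: NO.
-/

namespace Summit.Ventures.HodgeRepro2.Tier7

open Summit.Ventures.HodgeRepro2.ShimuraData.Liu

section LiuSection42

variable {K : Type*} [Field K] [NumberField K] [NumberField.IsCMField K]
  {c : IdeleConjugation K} {χEF : QuadraticCharacter K c}

namespace Hyp

/-- [cite: Liu2021, Cambridge J. Math. 9 (2021) no. 1, p. 47 ll. 10–22, Proposition 4.13; setting §4.2 p. 45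
ll. 45–64, p. 46 ll. 6–31 (`V` a totally definite incoherent hermitian space over `𝔸_E` of rank `n`, `G = U(V)`,
`X_K` the compactified Shimura variety `Sh(V)_K`, `A_K = Alb(X_K)`, `A_∞ = lim A_K`,
`H¹_{B,τ′}(A_∞, ℂ) = lim_K H¹_{B,τ′}(A_K, ℂ)`); Definition 4.11 p. 46 ll. 32–61 (adèlic oscillator triple
`(μ, ε, χ)`, `ω(μ, ε, χ) = ⊗_v ω(μ_v, ε_v, χ_v)` an irreducible admissible representation of `G(𝔸_F^∞)`);
Definition 4.12 p. 47 ll. 5–9 (`ε` μ-admissible)]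
«Proposition 4.13. Suppose that n ⩾ 3. Then for every embedding τ′ : E → C, there is an isomorphism
H¹_{B,τ′}(A_∞, C) ≃ ⊕_{(μ,ε,χ)} ω(μ, ε, χ) of C[G(A_F^∞)]-modules, where the direct sum is taken over all adèlic
oscillator triples in which μ is of weight one and ε is μ-admissible.»
[display: p2's `LiuProp413Shape K S` over the opaque shape `S : AlbaneseH1Shape K c χEF` (LiuOscillator p386919),
i.e. its MULTIPLICITY reading: `3 ≤ S.rank →` (a) every admissible triple `t` (μ weight one, ε μ-admissible) has
`S.mult τ′ (S.osc t) = 1` for every embedding `τ′` (the proof's sentence p. 49 l. 34 «the dimension of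
H¹_{B,τ′}(A_∞, C)[ω(μ, ε, χ)] is 1»), and (b) every `π` with `0 < S.mult τ′ π` is `S.osc t` of an admissible
`t` (no other constituent). The isomorphism of C[G(A_F^∞)]-modules itself is not a field of p2's shape; the
display is the statement read at the level of multiplicities (weaker as a typed object, never stronger).] -/
def Liu2021_Prop4_13 (S : AlbaneseH1Shape K c χEF) : Prop := LiuProp413Shape K S

/-- [cite: Liu2021, Cambridge J. Math. 9 (2021), p. 52 ll. 37–62, Theorem 4.18; Definition 4.16 p. 52 ll. 6–33
(`Ω(μ) := lim_{D_μ ∈ A(μ)} Hom_E(A_∞, A_μ)_ℚ` as an `M̃_μ[G(𝔸_F^∞)]`-module), Remark 4.17 ll. 34–36; Definition 4.5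
p. 42 ll. 8–39 (the CM data `D_μ = (A_μ, i_μ, λ_μ, r_μ)`, the category `A(μ)`)]
«Theorem 4.18. There is an isomorphism Ω(μ) ⊗_{M̃_μ} C ≃ ⊕_ε ⊕_χ ω(μ, ε, χ) of C[G(A_F^∞)]-modules, where the
direct sum is taken over all ε, χ such that ε is μ-admissible. Moreover, (1) For every object
D_μ = (A_μ, i_μ, λ_μ, r_μ) ∈ A(μ), we have a canonical isomorphism Ω(μ)^K ≃ Hom_E(A_K, A_μ)_Q for every sufficiently
small open compact subgroup K ⊆ G(A_F^∞). (2) The C[G(A_F^∞)]-modules in the direct sum in Theorem 4.18 are mutually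
non-isomorphic. (3) For every given ε that is μ-admissible, the subspace ⊕_χ ω(μ, ε, χ) is stable under the action
of Gal(C/M̃_μ).»
[display: p2's `LiuThm418Shape K S`: for every `μ` weight-one conjugate symplectic and every sufficiently small
level `K`, `S.omegaInvDim K μ = S.homDim K μ` — the DIMENSION reading of clause (1) (`Ω(μ)^K ≃ Hom_E(A_K, A_μ)_ℚ`);
the main isomorphism and clauses (2), (3) are not fields of p2's shape (weaker as a typed object, never
stronger). The pull-back mechanism of the proof (p. 52 ll. 63–80: `φ ↦ φ^*α`, `α` a basis of the `M̃_μ`-line of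
`H¹_{B,τ′}(A_μ, ℂ)`) is the printed reason a form of the `ω(μ,ε,χ)`-line of `H¹(X_K)` is the pull-back of a class
of `A_μ` along an element of `Hom_E(A_K, A_μ)_ℚ`.] -/
def Liu2021_Thm4_18 (S : AlbaneseH1Shape K c χEF) : Prop := LiuThm418Shape K S

/-- [cite: Liu2021, Cambridge J. Math. 9 (2021), p. 54 l. 49 – p. 55 l. 17, Corollary 4.20 (proof p. 55 l. 20
«This is a direct consequence of Theorem 4.18.»); Definition 4.19 p. 54 ll. 43–48]
«Corollary 4.20. Take an arbitrary object D_μ = (A_μ, i_μ, λ_μ, r_μ) ∈ A(μ). For every sufficiently small open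
compact subgroup K of G(A_F^∞), there is an isogeny decomposition A_K ∼ ∏_μ A_μ^{d(μ,K)}, resp.
A_K^{end} ∼ ∏_μ A_μ^{d(μ,K)} of abelian varieties over E when n ⩾ 3 (resp. n = 2), where the product is taken over
representatives of Gal(C/Q)-orbits of all conjugate symplectic automorphic characters of A_E^× of weight one.
Here, A_K^{end} is the endoscopic part of A_K when n = 2, defined in (D.3), and
d(μ, K) := Σ_ε Σ_χ dim_C ω(μ, ε, χ)^K, where the sum is taken over all ε, χ such that ε is μ-admissible.»
[display: p2's `LiuCor420Shape K S`, the `n ⩾ 3` branch: `3 ≤ S.rank → ∀ K small, ∃ reps T, …,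
S.albanese K = ∏_{μ ∈ reps} S.cmVariety μ ^ liuMultiplicity K S (T μ) K` with the printed side conditions (the `μ`
are weight-one conjugate symplectic, one per `Gal(ℂ/ℚ)`-orbit, the triples of `T μ` admissible with character `μ`,
completeness of `T μ` among the triples with non-zero `K`-invariants) and `liuMultiplicity` = `d(μ,K)` summed over
the DISTINCT representations `S.osc t`, `t ∈ T μ` (p2's reading of «Σ_ε Σ_χ»). The `n = 2` branch (`A_K^{end}`,
(D.3)) is not typed. RECORD CAVEAT (route/SOURCES.md F8): the Corollary does NOT assert `d(μ,K) > 0` for any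
particular `μ`; «the four corners are isogeny factors» (README §11) needs `1 ≤ d(μ_i, K)` for the four vertex
characters — in this tree `FaceOscillatorData.exists_common_level_liuMultiplicity` (LiuFace p387089) from
`OscillatorAdmissibleShape`.] -/
def Liu2021_Cor4_20 (S : AlbaneseH1Shape K c χEF) : Prop := LiuCor420Shape K S

end Hyp

end LiuSection42

/-! ## Appendix D.2 — the adelic Matsushima formula (D.1) as printed (p. 128 ll. 22–49) -/

/-- THE SHAPE of Liu 2021 Appendix D.2 (p. 128 ll. 22–46): the objects the formula (D.1) speaks about, as DATA
named as in print. «Let (G, h) be a Shimura data with E ⊆ C its reflex field. In particular, G is a reductive group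
over Q. Let ξ be an algebraic complex representation of G. Then it induces a complex local system L_ξ on
{Sh(G, h)_K ⊗_E C}. Let H^i_{(2)}(Sh(G, h)_K(C), L_ξ) be the i-th L²-cohomology of the complex manifold
Sh(G, h)_K(C) with coefficients in L_ξ. Put H^i_{(2)}(Sh(G, h), L_ξ) := lim_K H^i_{(2)}(Sh(G, h)_K(C), L_ξ), which
is a smooth representation of G(A^∞).» The carriers: `Gf` = `G(𝔸^∞)` (the group acting on the tower), `Hcoh i` =
`H^i_{(2)}(Sh(G, h), L_ξ)` with its `G(𝔸^∞)`-action `act`, `Rep` = «isomorphism classes of irreducible admissible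
representations π = π_∞ ⊗ π^∞ of G(A)», `mdisc π` = «the discrete multiplicity of π (Definition B.1)», `HgK π i` =
`H^i(𝔤, K_G; ξ_∞ ⊗ π_∞)` («g := Lie G_R, and K_G is a maximal connected compact subgroup of G(R)», «ξ_∞ is the
associated (g, K_G)-module of ξ»), `fin π` = `π^∞` with its `G(𝔸^∞)`-action `actFin`. Nothing is constructed. -/
structure Liu2021D1Shape where
  /-- `G(𝔸^∞)`, the finite-adelic group acting on the tower `{Sh(G, h)_K}_K` -/
  Gf : Type
  [instGroupGf : Group Gf]
  /-- `H^i_{(2)}(Sh(G, h), L_ξ) = lim_K H^i_{(2)}(Sh(G, h)_K(C), L_ξ)` (p. 128 ll. 27–31) -/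
  Hcoh : ℕ → Type
  [instAddHcoh : ∀ i, AddCommGroup (Hcoh i)]
  [instModHcoh : ∀ i, Module ℂ (Hcoh i)]
  /-- «which is a smooth representation of G(A^∞)» (p. 128 l. 33): the action of `G(𝔸^∞)` on `H^i_{(2)}` by
  ℂ-linear maps -/
  act : ∀ i, Gf →* (Hcoh i →ₗ[ℂ] Hcoh i)
  /-- «π = π_∞ ⊗ π^∞ runs through isomorphism classes of irreducible admissible representations of G(A)»
  (p. 128 l. 45) -/
  Rep : Type
  /-- «m_disc(π) is the discrete multiplicity of π (Definition B.1)» (p. 128 ll. 45–46) -/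
  mdisc : Rep → ℕ
  /-- `H^i(𝔤, K_G; ξ_∞ ⊗ π_∞)` — relative Lie algebra cohomology of the archimedean component (p. 128 ll. 37,
  42–44) -/
  HgK : Rep → ℕ → Type
  [instAddHgK : ∀ π i, AddCommGroup (HgK π i)]
  [instModHgK : ∀ π i, Module ℂ (HgK π i)]
  /-- `π^∞`, the finite part of `π`, a representation of `G(𝔸^∞)` -/
  fin : Rep → Type
  [instAddFin : ∀ π, AddCommGroup (fin π)]
  [instModFin : ∀ π, Module ℂ (fin π)]
  /-- the action of `G(𝔸^∞)` on `π^∞` by ℂ-linear maps -/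
  actFin : ∀ π, Gf →* (fin π →ₗ[ℂ] fin π)

namespace Liu2021D1Shape

variable (S : Liu2021D1Shape)

/-- the group structure of `G(𝔸^∞)` (field) -/
instance : Group S.Gf := S.instGroupGf
/-- the additive structure of `H^i_{(2)}(Sh(G,h), L_ξ)` (field) -/
instance (i : ℕ) : AddCommGroup (S.Hcoh i) := S.instAddHcoh i
/-- the ℂ-vector space structure of `H^i_{(2)}(Sh(G,h), L_ξ)` (field) -/
instance (i : ℕ) : Module ℂ (S.Hcoh i) := S.instModHcoh i
/-- the additive structure of `H^i(𝔤, K_G; ξ_∞ ⊗ π_∞)` (field) -/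
instance (π : S.Rep) (i : ℕ) : AddCommGroup (S.HgK π i) := S.instAddHgK π i
/-- the ℂ-vector space structure of `H^i(𝔤, K_G; ξ_∞ ⊗ π_∞)` (field) -/
instance (π : S.Rep) (i : ℕ) : Module ℂ (S.HgK π i) := S.instModHgK π i
/-- the additive structure of `π^∞` (field) -/
instance (π : S.Rep) : AddCommGroup (S.fin π) := S.instAddFin π
/-- the ℂ-vector space structure of `π^∞` (field) -/
instance (π : S.Rep) : Module ℂ (S.fin π) := S.instModFin π

open TensorProduct in
/-- the summand `m_disc(π) H^i(𝔤, K_G; ξ_∞ ⊗ π_∞) ⊗ π^∞` of (D.1): `m_disc(π)` copies of the tensor product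
`H^i(𝔤, K_G; ξ_∞ ⊗ π_∞) ⊗_ℂ π^∞` -/
abbrev summand (π : S.Rep) (i : ℕ) : Type := Fin (S.mdisc π) → (S.HgK π i ⊗[ℂ] S.fin π)

/-- the right-hand side of (D.1) in degree `i`: `⊕_π m_disc(π) H^i(𝔤, K_G; ξ_∞ ⊗ π_∞) ⊗ π^∞` -/
abbrev rhs (i : ℕ) : Type := DirectSum S.Rep (fun π => S.summand π i)

open TensorProduct in
/-- the `G(𝔸^∞)`-action on the summand of `π`: `g` acts through `π^∞` on the right tensor factor, trivially on
`H^i(𝔤, K_G; ξ_∞ ⊗ π_∞)`, and diagonally on the `m_disc(π)` copies -/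
noncomputable def actSummand (π : S.Rep) (i : ℕ) (g : S.Gf) : S.summand π i →ₗ[ℂ] S.summand π i :=
  LinearMap.pi fun j =>
    (TensorProduct.map (LinearMap.id : S.HgK π i →ₗ[ℂ] S.HgK π i) (S.actFin π g)).comp (LinearMap.proj j)

end Liu2021D1Shape

namespace Hyp

open Classical in
/-- [cite: Liu2021, Cambridge J. Math. 9 (2021), Appendix D.2, p. 128 ll. 33–49, display (D.1)] «By the Matsushima
formula for L²-cohomology, we have an isomorphism (D.1) H^i_{(2)}(Sh(G, h), L_ξ) ≃ ⊕_π m_disc(π) H^i(g, K_G;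
ξ_∞ ⊗ π_∞) ⊗ π^∞ of G(A^∞)-modules, where • g := Lie G_R, and K_G is a maximal connected compact subgroup of G(R),
• ξ_∞ is the associated (g, K_G)-module of ξ, and • π = π_∞ ⊗ π^∞ runs through isomorphism classes of irreducible
admissible representations of G(A), where m_disc(π) is the discrete multiplicity of π (Definition B.1). Here, we
have to use [BC83, Section 4] to conclude that the continuous part of L²(G(Q)\G(A), χ) does not contribute to the
L²-cohomology in the case of Shimura varieties.» (Footnote 22, p. 128 l. 55: «In this article, we only need the
case where ξ is the trivial representation.»; (D.2) p. 128 ll. 49–55 + p. 129 ll. 5–12: `H^i_{(2)} ≃ IH^i` by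
Zucker's conjecture, proved by Looijenga [Loo88] and Saper–Stern [SS90].)
[display: degree by degree (`i` = every `ℕ`): a ℂ-linear isomorphism `H^i_{(2)}(Sh(G,h), L_ξ) ≃ ⊕_π (m_disc(π)
copies of H^i(𝔤,K_G; ξ_∞ ⊗ π_∞) ⊗_ℂ π^∞)` which is `G(𝔸^∞)`-EQUIVARIANT («of G(A^∞)-modules»): for every `π`,
every element `v` of the `π`-summand and every `g`, the inverse image of `g · v` (with `g` acting on the
`π^∞`-factor, `actSummand`) is `g` applied to the inverse image of `v`. The [BC83] clause is the printed
justification of the statement, not a hypothesis of it. Not weakened (the equivariance IS the «of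
G(A^∞)-modules»), not strengthened (no finiteness clause is printed in (D.1); the finiteness of the sum is
Borel–Wallach VII 3.2's sentence, Tier7/Lit3).] -/
def Liu2021_D1_Matsushima (S : Liu2021D1Shape) : Prop :=
  ∀ i : ℕ, ∃ iso : S.Hcoh i ≃ₗ[ℂ] S.rhs i,
    ∀ (π : S.Rep) (v : S.summand π i) (g : S.Gf),
      iso.symm (DirectSum.lof ℂ S.Rep (fun π => S.summand π i) π (S.actSummand π i g v)) =
        S.act i g (iso.symm (DirectSum.lof ℂ S.Rep (fun π => S.summand π i) π v))

end Hyp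

end Summit.Ventures.HodgeRepro2.Tier7
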